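import Literature.Analysis.InnerProduct.KahanResidualMatching
import Literature.Analysis.InnerProduct.KahanResidualMatchingSharp
import Literature.Analysis.Matrix.IndexedEnclosureFromCount
import Literature.Analysis.Matrix.DefinitePencilInertia
import HarnessLib

/-!
# Residual pairing for the symmetric-definite pencil: Kahan's theorem through the reduction
# `X = RV`, `C = R⁻¹AR⁻¹` (`B = R²`), with the residual measured in the Euclidean norm and divided by `√β`

Golub–Van Loan, *Matrix Computations*, 4th ed. [GolubVanLoan2013], §8.7.1–§8.7.2: the symmetric-definite
pencil `Ax = λBx` (`A = Aᵀ`, `B = Bᵀ ≻ 0`) is the symmetric eigenproblem of the reduced matrix `C` (their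
`G⁻¹AG⁻ᵀ` with the Cholesky factor, Algorithm 8.7.1, `λ(A,B) = λ(C)`; here the symmetric square root
`R = B^{1/2}`, `C = R⁻¹AR⁻¹`, which has the same eigenvalues), and a `B`-orthonormal Ritz frame `V` of the pencil is an orthonormal frame `X = RV`
of `C`; Stewart–Sun, *Matrix Perturbation Theory* [StewartSun1990], Cor IV.4.15 / Exercise IV.4.7
(Kahan): an order-preserving pairing of the Ritz values with DISTINCT eigenvalues of `C` within the
residual norm `‖CX − XM‖₂`.  Since `CX − XM = R⁻¹(AV − BVM)` and `‖R⁻¹w‖² ≤ ‖w‖²/β` when `xᵀBx ≥ β·xᵀx`,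
**the pencil residual `‖AV − BVM‖₂`, divided by `√β`, pairs the Ritz values with pencil eigenvalues** —
the soundness statement of a «Lanczos proposes (eigsh with mass matrix), a pencil count certifies» kernel.

Typed here, over `ℝ`, with every operator norm unbundled as a pointwise inequality in the shape the tree's
`Literature.Analysis.InnerProduct.exists_strictMono_abs_eigenvalues₀_sub_le_of_gram_bounds` consumes:

* `exists_symm_sqrt_of_posDef`, `exists_symm_reduction_of_posDef` — `B ≻ 0` has a SYMMETRIC nonsingular
  square root `R` (`Rᵀ = R`, `B = RᵀR = R²`) and `A = RᵀCR` with `C` symmetric;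
* `exists_strictMono_abs_pencil_eigenvalues₀_sub_le` — **the pencil pairing**: `B`-Gram bounds
  `s²‖y‖² ≤ (Vy)ᵀB(Vy) ≤ S'²‖y‖²`, pencil residual `‖(AV − BVM)y‖² ≤ η²‖y‖²`, floor `β·xᵀx ≤ xᵀBx`
  (`β > 0`), `M` symmetric with spread `≤ 2δ` ⇒ a strictly increasing `f` with
  `|μ↓_{f j} − λ↓_j(M)| ≤ (η/√β)/s + (S'/s − 1)·δ`, `μ = λ(C)` the pencil eigenvalues
  (`DefinitePencilInertia`: `det(A − tB) = 0 ↔ t ∈ μ`);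
* `card_eigenvalues₀_lt_le_of_shifted_count` — the pencil COUNT certificate (tree
  `PencilCount.pencil_eigenvalue_counts_of_shifted_count`) in the form the indexing step wants:
  `#{j | μ↓_j < s₀ − τ/β} ≤ n − m`;
* `pencil_eigenvalues₀_indexed_of_pairing_of_count` — composed with the tree's
  `eigenvalues₀_pairing_indexed_of_count`: the paired pencil eigenvalues are the `k` SMALLEST ones, each
  Ritz interval `[θ_j − ρ, θ_j + ρ]` encloses its own pencil eigenvalue, and `s₀ − τ/β` bounds the rest
  from below (no pencil eigenvalue below the cut was missed).

Everything is proved; no definitions, no named facts, no floating point (the frame, the residual bound,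
the Gram bounds and the count are hypotheses in exactly the exact-arithmetic form a certificate reader
re-derives).  NOT here: the sharp radius `η/(√β·s)` without the `δ` term; complex Hermitian pencils;
that a particular eigensolver produced `V`.

## References
* [GolubVanLoan2013] G. H. Golub, C. F. Van Loan, *Matrix Computations*, 4th ed., Johns Hopkins 2013 —
  §8.7.1 (λ(A,B), congruence invariance), §8.7.2 Algorithm 8.7.1 (Cholesky reduction, λ(A,B) = λ(C)),
  Cor. 8.7.2 (simultaneous diagonalisation of a definite pair), §4.2.4 / Thm 4.2.7 (positive definite
  square root / Cholesky).
* [StewartSun1990] G. W. Stewart, J.-G. Sun, *Matrix Perturbation Theory*, Academic Press 1990 —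
  Cor IV.4.15 and Exercise IV.4.7 (Kahan's residual pairing), the theorem being transported.
-/

noncomputable section

open scoped Matrix

namespace Literature.Analysis.Matrix

namespace PencilCount

open Finset _root_.Matrix Literature.Analysis.ValidatedNumerics Literature.Analysis.InnerProduct

variable {ι : Type*} [Fintype ι] [DecidableEq ι]
variable {κ : Type*} [Fintype κ] [DecidableEq κ]
variable {A B C R : Matrix ι ι ℝ}

/-! ### §1 The symmetric square root of `B ≻ 0` -/

/-- **Symmetric nonsingular square root of a positive definite real matrix** (`R = U·diag(√b)·Uᵀ` from
the spectral decomposition `B = U·diag(b)·Uᵀ`, `b > 0`): `Rᵀ = R`, `det R` a unit, `B = RᵀR` (`= R²`).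
[cite: GolubVanLoan2013, §4.2.4 (the positive definite square root) / Thm 4.2.7] -/
theorem exists_symm_sqrt_of_posDef (hBpd : B.PosDef) :
    ∃ R : Matrix ι ι ℝ, Rᵀ = R ∧ IsUnit R.det ∧ B = Rᵀ * R := by
  set U : Matrix ι ι ℝ := (hBpd.1.eigenvectorUnitary : Matrix ι ι ℝ) with hU
  have hbpos : ∀ i, 0 < hBpd.1.eigenvalues i := fun i => hBpd.eigenvalues_pos i
  have hUU : U * Uᵀ = 1 := eigenvectorUnitary_mul_transpose hBpd.1
  have hUtU : Uᵀ * U = 1 := mul_eq_one_comm.mp hUU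
  have hRt : (U * diagonal (fun i => Real.sqrt (hBpd.1.eigenvalues i)) * Uᵀ)ᵀ
      = U * diagonal (fun i => Real.sqrt (hBpd.1.eigenvalues i)) * Uᵀ := by
    rw [transpose_mul, transpose_mul, transpose_transpose, diagonal_transpose, Matrix.mul_assoc]
  refine ⟨U * diagonal (fun i => Real.sqrt (hBpd.1.eigenvalues i)) * Uᵀ, hRt, ?_, ?_⟩
  · rw [det_mul, det_mul, det_transpose, det_diagonal]
    have hUd : IsUnit U.det := isUnit_det_of_right_inverse hUU
    refine (hUd.mul (IsUnit.mk0 _ (Finset.prod_ne_zero_iff.mpr fun i _ => ?_))).mul hUd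
    exact (Real.sqrt_pos.mpr (hbpos i)).ne'
  · have hsp := sub_smul_one_eq_eigenvectorUnitary_congruence hBpd.1 0
    rw [zero_smul, sub_zero] at hsp
    have hd : (fun i => Real.sqrt (hBpd.1.eigenvalues i) * Real.sqrt (hBpd.1.eigenvalues i))
        = fun i => hBpd.1.eigenvalues i - 0 :=
      funext fun i => by rw [sub_zero, Real.mul_self_sqrt (hbpos i).le]
    rw [hRt]
    calc B = U * diagonal (fun i => hBpd.1.eigenvalues i - 0) * Uᵀ := hsp
      _ = U * (diagonal (fun i => Real.sqrt (hBpd.1.eigenvalues i)) * (Uᵀ * U)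
            * diagonal (fun i => Real.sqrt (hBpd.1.eigenvalues i))) * Uᵀ := by
          rw [hUtU, Matrix.mul_one, diagonal_mul_diagonal, hd]
      _ = U * diagonal (fun i => Real.sqrt (hBpd.1.eigenvalues i)) * Uᵀ
            * (U * diagonal (fun i => Real.sqrt (hBpd.1.eigenvalues i)) * Uᵀ) := by
          simp only [Matrix.mul_assoc]

omit [DecidableEq ι] in
/-- A congruence `RᵀCR` of a real symmetric `C` is symmetric (private helper). [folklore] -/
private theorem isHermitian_transpose_mul_mul' (R : Matrix ι ι ℝ) (hC : C.IsHermitian) :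
    (Rᵀ * C * R).IsHermitian := by
  have h := isHermitian_conjTranspose_mul_mul R hC
  rwa [conjTranspose_eq_transpose_of_trivial] at h

/-- **Symmetric reduction of a symmetric-definite pencil** (Golub–Van Loan §8.7.2 Alg. 8.7.1 with the square root in
place of the Cholesky factor): for `A` symmetric and `B ≻ 0` there are `R` symmetric nonsingular and `C`
symmetric with `B = RᵀR`, `A = RᵀCR`. [cite: GolubVanLoan2013, §8.7.2 Alg. 8.7.1 (Cholesky reduction, λ(A,B) = λ(C)) + Cor. 8.7.2] -/
theorem exists_symm_reduction_of_posDef (hA : A.IsHermitian) (hBpd : B.PosDef) :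
    ∃ R C : Matrix ι ι ℝ, Rᵀ = R ∧ IsUnit R.det ∧ B = Rᵀ * R ∧ C.IsHermitian ∧ A = Rᵀ * C * R := by
  obtain ⟨R, hRs, hR, hB⟩ := exists_symm_sqrt_of_posDef hBpd
  refine ⟨R, R⁻¹ᵀ * A * R⁻¹, hRs, hR, hB, isHermitian_transpose_mul_mul' R⁻¹ hA, ?_⟩
  have h1 : Rᵀ * R⁻¹ᵀ = 1 := by rw [← transpose_mul, nonsing_inv_mul R hR, transpose_one]
  calc A = (Rᵀ * R⁻¹ᵀ) * A * (R⁻¹ * R) := by rw [h1, nonsing_inv_mul R hR, Matrix.one_mul, Matrix.mul_one]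
    _ = Rᵀ * (R⁻¹ᵀ * A * R⁻¹) * R := by simp only [Matrix.mul_assoc]

/-! ### §2 Kahan's pairing transported through the reduction -/

section Pairing

variable {V : Matrix ι κ ℝ} {M : Matrix κ κ ℝ}

omit [DecidableEq ι] in
/-- `Σᵢ ‖wᵢ‖² = w ⬝ w` over `ℝ` (private helper). [folklore] -/
private theorem sum_norm_sq_eq_dotProduct (w : ι → ℝ) : ∑ i, ‖w i‖ ^ 2 = w ⬝ᵥ w := by
  simp only [Real.norm_eq_abs, dotProduct, pow_two, abs_mul_abs_self]

omit [DecidableEq ι] [DecidableEq κ] in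
/-- The residual of the reduced problem is the pencil residual pulled back through `R`:
`R·(C·(RV) − (RV)·M) = AV − BVM` for `B = RᵀR`, `A = RᵀCR`, `Rᵀ = R` (private helper). [folklore] -/
private theorem mul_reduced_residual (hRs : Rᵀ = R) (hB : B = Rᵀ * R) (hAC : A = Rᵀ * C * R) :
    R * (C * (R * V) - R * V * M) = A * V - B * V * M := by
  rw [hB, hAC, hRs, Matrix.mul_sub]
  simp only [Matrix.mul_assoc]

/-- With `xᵀBx ≥ β·xᵀx` and `B = RᵀR` (`det R` a unit): `‖R⁻¹w‖² ≤ ‖w‖²/β`, written as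
`β·(R⁻¹w ⬝ R⁻¹w) ≤ w ⬝ w` (private helper). [folklore] -/
private theorem beta_mul_inv_mulVec_dotProduct_le (hR : IsUnit R.det) (hB : B = Rᵀ * R)
    {β : ℝ} (hBβ : ∀ x : ι → ℝ, β * (x ⬝ᵥ x) ≤ x ⬝ᵥ B *ᵥ x) (w : ι → ℝ) :
    β * ((R⁻¹ *ᵥ w) ⬝ᵥ (R⁻¹ *ᵥ w)) ≤ w ⬝ᵥ w := by
  have hw : R *ᵥ (R⁻¹ *ᵥ w) = w := by rw [mulVec_mulVec, mul_nonsing_inv R hR, one_mulVec]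
  have hq : (R⁻¹ *ᵥ w) ⬝ᵥ B *ᵥ (R⁻¹ *ᵥ w) = w ⬝ᵥ w := by
    conv_lhs => rw [hB, ← mulVec_mulVec, hw, dotProduct_mulVec, vecMul_transpose, hw]
  have h := hBβ (R⁻¹ *ᵥ w)
  rwa [hq] at h

/-- **Kahan's residual pairing for the symmetric-definite pencil (Stewart–Sun Cor IV.4.15 / Ex. IV.4.7
through the reduction of Golub–Van Loan §8.7.2 Alg. 8.7.1).** Let `B = RᵀR`, `A = RᵀCR` with `R` symmetric
nonsingular and `C` symmetric (pencil eigenvalues `μ↓ = hC.eigenvalues₀`, descending), `xᵀBx ≥ β·xᵀx`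
(`β > 0`); let the frame `V` have `B`-Gram bounds `s²·Σ‖y_j‖² ≤ (Vy)ᵀB(Vy) ≤ S'²·Σ‖y_j‖²` (`0 < s`,
`0 ≤ S'`), pencil residual `Σᵢ‖((AV − BVM)y)ᵢ‖² ≤ η²·Σ‖y_j‖²` (`η ≥ 0`), and `M` symmetric with
`λ↓_{j'}(M) − λ↓_j(M) ≤ 2δ`.  Then there is a strictly increasing `f` with
`|μ↓_{f j} − λ↓_j(M)| ≤ (η/√β)/s + (S'/s − 1)·δ` for every `j` — each Ritz value owns a DISTINCT pencil
eigenvalue within that radius. [cite: StewartSun1990, Cor IV.4.15 + Exercise IV.4.7 (via GolubVanLoan2013 §8.7.2 Alg. 8.7.1 reduction)] -/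
theorem exists_strictMono_abs_pencil_eigenvalues₀_sub_le (hC : C.IsHermitian) (hM : M.IsHermitian)
    (hRs : Rᵀ = R) (hR : IsUnit R.det) (hB : B = Rᵀ * R) (hAC : A = Rᵀ * C * R)
    {β s S' η δ : ℝ} (hβ : 0 < β) (hBβ : ∀ x : ι → ℝ, β * (x ⬝ᵥ x) ≤ x ⬝ᵥ B *ᵥ x)
    (hs : 0 < s) (hS' : 0 ≤ S') (hη : 0 ≤ η)
    (hVlow : ∀ y : κ → ℝ, s ^ 2 * ∑ j, ‖y j‖ ^ 2 ≤ (V *ᵥ y) ⬝ᵥ B *ᵥ (V *ᵥ y))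
    (hVup : ∀ y : κ → ℝ, (V *ᵥ y) ⬝ᵥ B *ᵥ (V *ᵥ y) ≤ S' ^ 2 * ∑ j, ‖y j‖ ^ 2)
    (hres : ∀ y : κ → ℝ, ∑ i, ‖((A * V - B * V * M) *ᵥ y) i‖ ^ 2 ≤ η ^ 2 * ∑ j, ‖y j‖ ^ 2)
    (hδ : ∀ j j' : Fin (Fintype.card κ), hM.eigenvalues₀ j' - hM.eigenvalues₀ j ≤ 2 * δ) :
    ∃ f : Fin (Fintype.card κ) → Fin (Fintype.card ι), StrictMono f ∧
      ∀ j, |hC.eigenvalues₀ (f j) - hM.eigenvalues₀ j| ≤ (η / Real.sqrt β) / s + (S' / s - 1) * δ := by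
  have hXform : ∀ y : κ → ℝ, ∑ i, ‖((R * V) *ᵥ y) i‖ ^ 2 = (V *ᵥ y) ⬝ᵥ B *ᵥ (V *ᵥ y) := fun y => by
    rw [sum_norm_sq_eq_dotProduct, ← mulVec_mulVec]
    conv_rhs => rw [hB, ← mulVec_mulVec, dotProduct_mulVec, vecMul_transpose]
  refine exists_strictMono_abs_eigenvalues₀_sub_le_of_gram_bounds (𝕜 := ℝ) hC (R * V) hM hs hS'
    (div_nonneg hη (Real.sqrt_nonneg β)) (fun y => ?_) (fun y => ?_) (fun y => ?_) hδ
  · rw [hXform]; exact hVlow y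
  · rw [hXform]; exact hVup y
  · -- the reduced residual is `R⁻¹ (AV − BVM)`; its norm is at most `1/√β` times the pencil residual's
    have hred : C * (R * V) - R * V * M = R⁻¹ * (A * V - B * V * M) := by
      rw [← mul_reduced_residual hRs hB hAC, ← Matrix.mul_assoc R⁻¹ R, nonsing_inv_mul R hR, Matrix.one_mul]
    rw [hred, ← mulVec_mulVec, sum_norm_sq_eq_dotProduct]
    have hb := beta_mul_inv_mulVec_dotProduct_le hR hB hBβ ((A * V - B * V * M) *ᵥ y)
    have hr := hres y
    rw [sum_norm_sq_eq_dotProduct] at hr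
    have hsq : (η / Real.sqrt β) ^ 2 = η ^ 2 / β := by
      rw [div_pow, Real.sq_sqrt hβ.le]
    rw [hsq, div_mul_eq_mul_div, le_div_iff₀ hβ, mul_comm]
    have hyy : 0 ≤ ∑ j, ‖y j‖ ^ 2 := Finset.sum_nonneg fun j _ => by positivity
    nlinarith [hb, hr, hyy]

end Pairing

/-! ### §3 The count in indexing form and the composition -/

omit [DecidableEq ι] in
/-- Counting over the matrix index `ι` or over the sorted index `Fin |ι|` gives the same number (private
helper). [folklore] -/
private theorem card_filter_eigenvalues_eq_card_filter_eigenvalues₀' [DecidableEq ι] {W : Matrix ι ι ℝ}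
    (hW : W.IsHermitian) (p : ℝ → Prop) [DecidablePred p] :
    (univ.filter fun i : ι => p (hW.eigenvalues i)).card =
      (univ.filter fun j : Fin (Fintype.card ι) => p (hW.eigenvalues₀ j)).card := by
  rw [← Fintype.card_subtype, ← Fintype.card_subtype]
  exact Fintype.card_congr (Equiv.subtypeEquiv
    (Fintype.equivOfCardEq (Fintype.card_fin _)).symm fun i => Iff.rfl)

/-- **The pencil count certificate in indexing form.** Under the hypotheses of
`pencil_eigenvalue_counts_of_shifted_count` (count for `W = A − s₀·B` with slack `τ`, floor `β`, at least
`m` matrix eigenvalues above `−τ`, reduction `B = RᵀR`, `A = RᵀCR`): at most `n − m` pencil eigenvalues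
lie strictly below `s₀ − τ/β`. [cite: GolubVanLoan2013, §8.7.1–§8.7.2 (Alg. 8.7.1) with §8.4.2 (spectrum slicing)] -/
theorem card_eigenvalues₀_lt_le_of_shifted_count (hA : A.IsHermitian) (hBh : B.IsHermitian) {β : ℝ}
    (hβ : 0 < β) (hBβ : ∀ x : ι → ℝ, β * (x ⬝ᵥ x) ≤ x ⬝ᵥ B *ᵥ x) {τ : ℝ} (hτ : 0 ≤ τ) (s₀ : ℝ)
    {m : ℕ} (hW : (A - s₀ • B).IsHermitian)
    (hup : (univ.filter fun i => τ < hW.eigenvalues i).card ≤ m)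
    (hlow : m ≤ (univ.filter fun i => -τ < hW.eigenvalues i).card)
    (hC : C.IsHermitian) (hR : IsUnit R.det) (hB : B = Rᵀ * R) (hAC : A = Rᵀ * C * R) :
    (univ.filter fun j : Fin (Fintype.card ι) => hC.eigenvalues₀ j < s₀ - τ / β).card
      ≤ Fintype.card ι - m := by
  have h := (pencil_eigenvalue_counts_of_shifted_count hA hBh hβ hBβ hτ s₀ hW hup hlow hC hR hB hAC).2
  rw [card_filter_eigenvalues_eq_card_filter_eigenvalues₀' hC (s₀ - τ / β < ·)] at h
  have hdisj : Disjoint (univ.filter fun j : Fin (Fintype.card ι) => hC.eigenvalues₀ j < s₀ - τ / β)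
      (univ.filter fun j : Fin (Fintype.card ι) => s₀ - τ / β < hC.eigenvalues₀ j) :=
    disjoint_filter.2 fun j _ hj hj' => lt_asymm hj hj'
  have hle := card_le_univ ((univ.filter fun j : Fin (Fintype.card ι) => hC.eigenvalues₀ j < s₀ - τ / β)
      ∪ (univ.filter fun j : Fin (Fintype.card ι) => s₀ - τ / β < hC.eigenvalues₀ j))
  rw [card_union_of_disjoint hdisj, Fintype.card_fin] at hle
  omega

/-- **Indexed enclosures of the smallest pencil eigenvalues from a pairing and a pencil count** (the
soundness statement of a «generalized Lanczos proposes, a pencil `LDLᵀ` count certifies» kernel).  With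
the pencil pairing `f` of `exists_strictMono_abs_pencil_eigenvalues₀_sub_le` (radius `ρ`, Ritz values
`θ_j = λ↓_j(M)`, `k = |κ|` of them), a pencil count certificate at `s₀` as in
`card_eigenvalues₀_lt_le_of_shifted_count` with `n − m ≤ k`, and the gap `θ_j + ρ < s₀ − τ/β` for all `j`:
`f j = n − k + j` (the paired pencil eigenvalues are the `k` smallest, in order), `θ_j − ρ ≤ μ↓_{f j} ≤
θ_j + ρ`, and `s₀ − τ/β ≤ μ↓_i` for every `i < n − k` — no pencil eigenvalue below the cut was missed.
[cite: StewartSun1990, Cor IV.4.15 (pairing) composed with GolubVanLoan2013 §8.7.2 Alg. 8.7.1 / §8.4.2 (count)] -/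
theorem pencil_eigenvalues₀_indexed_of_pairing_of_count (hA : A.IsHermitian) (hBh : B.IsHermitian)
    {β : ℝ} (hβ : 0 < β) (hBβ : ∀ x : ι → ℝ, β * (x ⬝ᵥ x) ≤ x ⬝ᵥ B *ᵥ x) {τ : ℝ} (hτ : 0 ≤ τ) (s₀ : ℝ)
    {m : ℕ} (hW : (A - s₀ • B).IsHermitian)
    (hup : (univ.filter fun i => τ < hW.eigenvalues i).card ≤ m)
    (hlow : m ≤ (univ.filter fun i => -τ < hW.eigenvalues i).card)
    (hC : C.IsHermitian) (hR : IsUnit R.det) (hB : B = Rᵀ * R) (hAC : A = Rᵀ * C * R)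
    {k : ℕ} (hk : Fintype.card ι - m ≤ k) {θ : Fin k → ℝ} {ρ : ℝ}
    {f : Fin k → Fin (Fintype.card ι)} (hf : StrictMono f)
    (hpair : ∀ j, |hC.eigenvalues₀ (f j) - θ j| ≤ ρ) (hsep : ∀ j, θ j + ρ < s₀ - τ / β) :
    (∀ j, (f j : ℕ) = Fintype.card ι - k + j ∧
        θ j - ρ ≤ hC.eigenvalues₀ (f j) ∧ hC.eigenvalues₀ (f j) ≤ θ j + ρ) ∧
      ∀ i : Fin (Fintype.card ι), (i : ℕ) < Fintype.card ι - k → s₀ - τ / β ≤ hC.eigenvalues₀ i :=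
  eigenvalues₀_pairing_indexed_of_count hC hf hpair hsep
    ((card_eigenvalues₀_lt_le_of_shifted_count hA hBh hβ hBβ hτ s₀ hW hup hlow hC hR hB hAC).trans hk)

/-! ### §4 A FAMILY of stiffness data: Weyl's perturbation theorem through the reduction
(appended 2026-08-27, certnum-ila-2 gen 3 — the widening a certificate applies when the client's exact
`A'` differs from the binary64 centre `A` by an entrywise radius, folded into a form bound `ϱ`) -/

section Family

variable {A' C' : Matrix ι ι ℝ}

/-- The perturbation of the reduced matrix is the congruence of the perturbation of the stiffness data:
`xᵀ(C' − C)x = (R⁻¹x)ᵀ(A' − A)(R⁻¹x)` for `A = RᵀCR`, `A' = RᵀC'R`, `R` nonsingular (private helper).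
[folklore] -/
private theorem dotProduct_sub_reduced_mulVec (hR : IsUnit R.det)
    (hAC : A = Rᵀ * C * R) (hAC' : A' = Rᵀ * C' * R) (x : ι → ℝ) :
    x ⬝ᵥ (C' - C) *ᵥ x = (R⁻¹ *ᵥ x) ⬝ᵥ (A' - A) *ᵥ (R⁻¹ *ᵥ x) := by
  have hw : R *ᵥ (R⁻¹ *ᵥ x) = x := by rw [mulVec_mulVec, mul_nonsing_inv R hR, one_mulVec]
  have hΔ : A' - A = Rᵀ * (C' - C) * R := by rw [hAC, hAC', Matrix.mul_sub, Matrix.sub_mul]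
  conv_rhs => rw [hΔ, ← mulVec_mulVec, ← mulVec_mulVec, hw, dotProduct_mulVec, vecMul_transpose, hw]

/-- **Weyl widening for the symmetric-definite pencil (a family of stiffness matrices).** Let `B = RᵀR`
(`R` nonsingular — any reduction, symmetric or Cholesky; `xᵀBx ≥ β·xᵀx`, `β > 0`), `A = RᵀCR`,
`A' = RᵀC'R` with `C`, `C'` symmetric
(pencil eigenvalues `μ↓ = λ↓(C)` of `(A, B)` and `μ'↓ = λ↓(C')` of `(A', B)`), and let the data
perturbation satisfy the form bound `|yᵀ(A' − A)y| ≤ ϱ·yᵀy` (`ϱ ≥ 0`; e.g. Schur's row-sum bound of an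
entrywise radius, tree `EigenvalueCount.abs_dotProduct_mulVec_le_of_abs_le_rowSum`).  Then every sorted
pencil eigenvalue moves by at most `ϱ/β`: `|μ'↓_j − μ↓_j| ≤ ϱ/β` — so an enclosure certified for the
binary64 centre `A` holds for every member of the family after widening by `ϱ/β`.
[cite: HornJohnson2013, Cor. 4.3.15 eq. (4.3.16) (Weyl) through GolubVanLoan2013 §8.7.2 Alg. 8.7.1 (reduction)] -/
theorem abs_pencil_eigenvalues₀_sub_le_div (hC : C.IsHermitian) (hC' : C'.IsHermitian)
    (hR : IsUnit R.det) (hB : B = Rᵀ * R) (hAC : A = Rᵀ * C * R) (hAC' : A' = Rᵀ * C' * R)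
    {β ϱ : ℝ} (hβ : 0 < β) (hBβ : ∀ x : ι → ℝ, β * (x ⬝ᵥ x) ≤ x ⬝ᵥ B *ᵥ x) (hϱ : 0 ≤ ϱ)
    (hΔ : ∀ y : ι → ℝ, |y ⬝ᵥ (A' - A) *ᵥ y| ≤ ϱ * (y ⬝ᵥ y)) (j : Fin (Fintype.card ι)) :
    |hC'.eigenvalues₀ j - hC.eigenvalues₀ j| ≤ ϱ / β := by
  have hCE : (C + (C' - C)).IsHermitian := by rw [add_sub_cancel]; exact hC'
  have hE : ∀ x : ι → ℝ, |x ⬝ᵥ (C' - C) *ᵥ x| ≤ ϱ / β * (x ⬝ᵥ x) := fun x => by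
    rw [dotProduct_sub_reduced_mulVec hR hAC hAC' x]
    have h1 := hΔ (R⁻¹ *ᵥ x)
    have h2 := beta_mul_inv_mulVec_dotProduct_le hR hB hBβ x
    have h3 : ϱ * ((R⁻¹ *ᵥ x) ⬝ᵥ (R⁻¹ *ᵥ x)) ≤ ϱ / β * (x ⬝ᵥ x) := by
      rw [div_mul_eq_mul_div, le_div_iff₀ hβ]
      nlinarith [h2, hϱ]
    exact h1.trans h3
  have h := KyFan.abs_eigenvalues₀_add_sub_le hC hCE hE j
  have heq : hCE.eigenvalues₀ = hC'.eigenvalues₀ := by congr 1; exact add_sub_cancel C C'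
  rw [heq] at h
  exact h

end Family

/-! ### §5 The SHARP pencil pairing: radius `(η/√β)/σ_min`, no spread term
(appended 2026-08-27, certnum-ila-2 gen 7 — the Cao–Xie–Li form of §2, transported through the same
reduction; consumes the tree's `exists_strictMono_abs_eigenvalues₀_sub_le_of_gram_lower`) -/

section SharpPairing

variable {V : Matrix ι κ ℝ} {M : Matrix κ κ ℝ}

/-- **Sharp residual pairing for the symmetric-definite pencil (Cao–Xie–Li 1996 through the reduction
of Golub–Van Loan §8.7.2 Alg. 8.7.1).** Let `B = RᵀR`, `A = RᵀCR` with `R` symmetric nonsingular and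
`C` symmetric (pencil eigenvalues `μ↓ = hC.eigenvalues₀`, descending), `xᵀBx ≥ β·xᵀx` (`β > 0`); let the
frame `V` have ONLY a `B`-Gram LOWER bound `s²·Σ‖y_j‖² ≤ (Vy)ᵀB(Vy)` (`0 < s`; `σ_min` of `RV`) and
pencil residual `Σᵢ‖((AV − BVM)y)ᵢ‖² ≤ η²·Σ‖y_j‖²` (`η ≥ 0`), `M` symmetric (ANY spread). Then there is
a strictly increasing `f` with `|μ↓_{f j} − λ↓_j(M)| ≤ (η/√β)/s` for every `j` — the radius of §2's
`exists_strictMono_abs_pencil_eigenvalues₀_sub_le` WITHOUT its `(S'/s − 1)·δ` term (the reduced frame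
`X = RV` has `‖Xy‖² = (Vy)ᵀB(Vy) ≥ s²‖y‖²` and residual `CX − XM = R⁻¹(AV − BVM)` of norm `≤ η/√β`).
[cite: Lange2020, §4.4 Thm 3 (via GolubVanLoan2013 §8.7.2 Alg. 8.7.1 reduction)] [cite: CaoXieLi1996, main theorem] -/
theorem exists_strictMono_abs_pencil_eigenvalues₀_sub_le_sharp (hC : C.IsHermitian)
    (hM : M.IsHermitian) (hRs : Rᵀ = R) (hR : IsUnit R.det) (hB : B = Rᵀ * R) (hAC : A = Rᵀ * C * R)
    {β s η : ℝ} (hβ : 0 < β) (hBβ : ∀ x : ι → ℝ, β * (x ⬝ᵥ x) ≤ x ⬝ᵥ B *ᵥ x)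
    (hs : 0 < s) (hη : 0 ≤ η)
    (hVlow : ∀ y : κ → ℝ, s ^ 2 * ∑ j, ‖y j‖ ^ 2 ≤ (V *ᵥ y) ⬝ᵥ B *ᵥ (V *ᵥ y))
    (hres : ∀ y : κ → ℝ, ∑ i, ‖((A * V - B * V * M) *ᵥ y) i‖ ^ 2 ≤ η ^ 2 * ∑ j, ‖y j‖ ^ 2) :
    ∃ f : Fin (Fintype.card κ) → Fin (Fintype.card ι), StrictMono f ∧
      ∀ j, |hC.eigenvalues₀ (f j) - hM.eigenvalues₀ j| ≤ (η / Real.sqrt β) / s := by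
  have hXform : ∀ y : κ → ℝ, ∑ i, ‖((R * V) *ᵥ y) i‖ ^ 2 = (V *ᵥ y) ⬝ᵥ B *ᵥ (V *ᵥ y) := fun y => by
    rw [sum_norm_sq_eq_dotProduct, ← mulVec_mulVec]
    conv_rhs => rw [hB, ← mulVec_mulVec, dotProduct_mulVec, vecMul_transpose]
  refine exists_strictMono_abs_eigenvalues₀_sub_le_of_gram_lower (𝕜 := ℝ) hC (R * V) hM hs
    (div_nonneg hη (Real.sqrt_nonneg β)) (fun y => ?_) (fun y => ?_)
  · rw [hXform]; exact hVlow y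
  · -- the reduced residual is `R⁻¹ (AV − BVM)`; its norm is at most `1/√β` times the pencil residual's
    have hred : C * (R * V) - R * V * M = R⁻¹ * (A * V - B * V * M) := by
      rw [← mul_reduced_residual hRs hB hAC, ← Matrix.mul_assoc R⁻¹ R, nonsing_inv_mul R hR, Matrix.one_mul]
    rw [hred, ← mulVec_mulVec, sum_norm_sq_eq_dotProduct]
    have hb := beta_mul_inv_mulVec_dotProduct_le hR hB hBβ ((A * V - B * V * M) *ᵥ y)
    have hr := hres y
    rw [sum_norm_sq_eq_dotProduct] at hr
    have hsq : (η / Real.sqrt β) ^ 2 = η ^ 2 / β := by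
      rw [div_pow, Real.sq_sqrt hβ.le]
    rw [hsq, div_mul_eq_mul_div, le_div_iff₀ hβ, mul_comm]
    have hyy : 0 ≤ ∑ j, ‖y j‖ ^ 2 := Finset.sum_nonneg fun j _ => by positivity
    nlinarith [hb, hr, hyy]

/-- **Indexed enclosures of the smallest pencil eigenvalues, sharp radius.** The composition
`pencil_eigenvalues₀_indexed_of_pairing_of_count` fed with the sharp pairing: with the `B`-Gram lower
bound `s`, pencil residual `η`, floor `β`, a pencil count certificate at `s₀` (slack `τ`, at least `m`
matrix eigenvalues of `A − s₀B` above `−τ`, `n − m ≤ k`) and the gap `θ_j + ρ < s₀ − τ/β` for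
`ρ = (η/√β)/s` and `θ_j = λ↓_j(M)`: the paired pencil eigenvalues are the `k` smallest, in order,
`θ_j − ρ ≤ μ↓_{n−k+j} ≤ θ_j + ρ`, and `s₀ − τ/β ≤ μ↓_i` for every `i < n − k`.
[cite: Lange2020, §4.4 Thm 3 (pairing) composed with GolubVanLoan2013 §8.7.2 Alg. 8.7.1 / §8.4.2 (count)] -/
theorem pencil_eigenvalues₀_indexed_of_count_sharp (hA : A.IsHermitian) (hBh : B.IsHermitian)
    (hC : C.IsHermitian) (hM : M.IsHermitian) (hRs : Rᵀ = R) (hR : IsUnit R.det) (hB : B = Rᵀ * R)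
    (hAC : A = Rᵀ * C * R) {β s η : ℝ} (hβ : 0 < β) (hBβ : ∀ x : ι → ℝ, β * (x ⬝ᵥ x) ≤ x ⬝ᵥ B *ᵥ x)
    (hs : 0 < s) (hη : 0 ≤ η)
    (hVlow : ∀ y : κ → ℝ, s ^ 2 * ∑ j, ‖y j‖ ^ 2 ≤ (V *ᵥ y) ⬝ᵥ B *ᵥ (V *ᵥ y))
    (hres : ∀ y : κ → ℝ, ∑ i, ‖((A * V - B * V * M) *ᵥ y) i‖ ^ 2 ≤ η ^ 2 * ∑ j, ‖y j‖ ^ 2)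
    {τ : ℝ} (hτ : 0 ≤ τ) (s₀ : ℝ) {m : ℕ} (hW : (A - s₀ • B).IsHermitian)
    (hup : (univ.filter fun i => τ < hW.eigenvalues i).card ≤ m)
    (hlow : m ≤ (univ.filter fun i => -τ < hW.eigenvalues i).card)
    (hk : Fintype.card ι - m ≤ Fintype.card κ)
    (hsep : ∀ j, hM.eigenvalues₀ j + (η / Real.sqrt β) / s < s₀ - τ / β) :
    ∃ f : Fin (Fintype.card κ) → Fin (Fintype.card ι), StrictMono f ∧
      (∀ j, (f j : ℕ) = Fintype.card ι - Fintype.card κ + j ∧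
          hM.eigenvalues₀ j - (η / Real.sqrt β) / s ≤ hC.eigenvalues₀ (f j) ∧
          hC.eigenvalues₀ (f j) ≤ hM.eigenvalues₀ j + (η / Real.sqrt β) / s) ∧
      ∀ i : Fin (Fintype.card ι), (i : ℕ) < Fintype.card ι - Fintype.card κ →
        s₀ - τ / β ≤ hC.eigenvalues₀ i := by
  obtain ⟨f, hf, hpair⟩ := exists_strictMono_abs_pencil_eigenvalues₀_sub_le_sharp hC hM hRs hR hB
    hAC hβ hBβ hs hη hVlow hres
  exact ⟨f, hf, pencil_eigenvalues₀_indexed_of_pairing_of_count hA hBh hβ hBβ hτ s₀ hW hup hlow hC hR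
    hB hAC hk hf hpair hsep⟩

end SharpPairing

end PencilCount

end Literature.Analysis.Matrix
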